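import Mathlib
import Summits.HodgeConjecture.HodgeConjecture.Theorems.HodgeLocusLVRamifiedGuard
import Summits.HodgeConjecture.HodgeConjecture.Theorems.HodgeLocusLVUnitSquare

/-!
# Hodge-locus census (cell `pub-hlocus`, ENGINE A, gen 46) — the ramified cell (R) from a symbol-free
NON-SQUARE hypothesis

certified instances and evidence bearing on the general Hodge conjecture; no claim.

GENERAL, DEFINITION-FREE composition sheet (no census data).  `HodgeLocusLVRamifiedGuard.lean` proves the
(R)-law of the three-cell term-wise law (DERIVATION-GK-A.md §5af Lemma 4; terms `a·(ℓ^{v_x} m′_x) + X_x² = D`,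
`ℓ` prime, `ℓ ∤ a m′_x`, local factor `c ≡ 1`) from the valuation hypothesis
`hsq : X_x ≠ 0 → ρ_x F(m′_x) ≠ 0 → ¬ 2·v_ℓ(X_x) < v_ℓ(D)`; `HodgeLocusLVUnitSquare.lean` proves (Hensel in
`ℤ_[ℓ]`) that in the excluded case `−a·m_x = X_x² − D` IS an `ℓ`-adic square (`ℓ` odd).  HERE the two are
composed: for an odd prime `ℓ` the (R)-law follows from the SYMBOL-FREE hypothesis
  `hnsq : X_x ≠ 0 → ρ_x F(m′_x) ≠ 0 → ¬ IsSquare (−(a·m_x) : ℤ_[ℓ])`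
("a nonzero core term with `x ≠ 0` has `−a·m_x` a NON-square in `ℤ_ℓ`"), which is exactly what §5af's
Lemma 2 delivers through the Hilbert symbol: a nonzero term has `(d₁, −a·m_x)_ℓ = (d₁, −m_x)_ℓ = −1`
(`a = 4` a square), while `(d₁, z²)_ℓ = +1` for every nonzero square.  That last reading (the symbol, the
product formula) is the ONLY step of §5af (R) for odd `ℓ` not kernel-checked after this file; it stays a
hypothesis, and no internally-minted statement is cited as a fact.  Theorems: `guarded_of_nonsquare`,
`law_ramified_of_nonsquare` (`T_r = Σ_x ρ_x F(m′_x)` for `r ≤ v_ℓ(D)`), `law_ramified_eq_zero_of_odd_nonsquare`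
(`v_ℓ(D)` odd ⇒ `T_r = 0` for `r > v_ℓ(D)`).  SCOPE: odd `ℓ` with `ℓ ∤ a` only (the cell's `a = 4`); the
`ℓ = 2` ramified rows are the domain of ENGINE B's `HodgeLocusLVTermwiseLawTwoB*.lean` sheets, where the
symbol `+1` off the top class comes from explicit `2`-adic unit computations, not from squareness (LEAD remark
N-LVUS-1).  Mechanism references: [cite: LauterViray2015SingularModuli, Thm. 1.5],
[cite: GrossZagier1985SingularModuli, Thm. 1.3].  No `sorry`, no new axioms, no definitions; accepted files
are not edited.
-/

namespace Summit.HodgeConjecture.HodgeConjecture.HodgeLocus.Census.LVRamifiedNonsquare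

open Finset
open Summit.HodgeConjecture.HodgeConjecture.HodgeLocus.Census.LVRamifiedGuard
open Summit.HodgeConjecture.HodgeConjecture.HodgeLocus.Census.LVUnitSquare

set_option linter.dupNamespace false

variable {ι : Type*} {ℓ : ℕ} [Fact ℓ.Prime] (s : Finset ι) (F : ℕ → ℤ) (c : ℕ → ℤ) (ρ : ι → ℤ)
  (m' v : ι → ℕ)

/-- `ℓ` odd: the non-square hypothesis implies the guarded valuation hypothesis `hsq` (contrapositive of
`LVUnitSquare.isSquare_neg_mul_of_lt`). -/
theorem guarded_of_nonsquare (hℓ2 : ℓ ≠ 2) {a D : ℕ} (X : ι → ℕ)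
    (hshape : ∀ x ∈ s, a * (ℓ ^ v x * m' x) + X x ^ 2 = D)
    (hnsq : ∀ x ∈ s, X x ≠ 0 → ρ x * F (m' x) ≠ 0 →
      ¬ IsSquare (-((a * (ℓ ^ v x * m' x) : ℕ) : ℤ_[ℓ]))) :
    ∀ x ∈ s, X x ≠ 0 → ρ x * F (m' x) ≠ 0 → ¬ 2 * (X x).factorization ℓ < D.factorization ℓ :=
  fun x hx hX hw hlt => hnsq x hx hX hw (isSquare_neg_mul_of_lt hℓ2 hX (hshape x hx) hlt)

/-- (R), floor, from the NON-SQUARE hypothesis (`ℓ` odd prime, `ℓ ∤ a m′_x`, `c ≡ 1`):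
`T_r = Σ_x ρ_x F(m′_x)` for every `r ≤ v_ℓ(D)`. -/
theorem law_ramified_of_nonsquare (hℓ2 : ℓ ≠ 2)
    (hF : ∀ e n, ¬ ℓ ∣ n → F (ℓ ^ e * n) = c e * F n) (hc : ∀ e, c e = 1)
    (hm' : ∀ x ∈ s, ¬ ℓ ∣ m' x) {a D : ℕ} (ha : ¬ ℓ ∣ a) (X : ι → ℕ)
    (hshape : ∀ x ∈ s, a * (ℓ ^ v x * m' x) + X x ^ 2 = D)
    (hnsq : ∀ x ∈ s, X x ≠ 0 → ρ x * F (m' x) ≠ 0 →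
      ¬ IsSquare (-((a * (ℓ ^ v x * m' x) : ℕ) : ℤ_[ℓ])))
    {r : ℕ} (hr : r ≤ D.factorization ℓ) :
    ∑ x ∈ s, (if ℓ ^ r ∣ ℓ ^ v x * m' x then ρ x * F (ℓ ^ v x * m' x / ℓ ^ r) else 0)
      = ∑ x ∈ s, ρ x * F (m' x) :=
  law_ramified_of_shape_guarded s F c ρ m' v Fact.out hF hc hm' ha X hshape
    (guarded_of_nonsquare s F ρ m' v hℓ2 X hshape hnsq) hr

/-- (R), ceiling, from the NON-SQUARE hypothesis: `v_ℓ(D)` odd ⇒ `T_r = 0` for every `r > v_ℓ(D)`. -/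
theorem law_ramified_eq_zero_of_odd_nonsquare (hℓ2 : ℓ ≠ 2)
    (hF : ∀ e n, ¬ ℓ ∣ n → F (ℓ ^ e * n) = c e * F n)
    (hm' : ∀ x ∈ s, ¬ ℓ ∣ m' x) {a D : ℕ} (ha : ¬ ℓ ∣ a) (X : ι → ℕ)
    (hshape : ∀ x ∈ s, a * (ℓ ^ v x * m' x) + X x ^ 2 = D)
    (hnsq : ∀ x ∈ s, X x ≠ 0 → ρ x * F (m' x) ≠ 0 →
      ¬ IsSquare (-((a * (ℓ ^ v x * m' x) : ℕ) : ℤ_[ℓ])))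
    (hE : Odd (D.factorization ℓ)) {r : ℕ} (hr : D.factorization ℓ < r) :
    ∑ x ∈ s, (if ℓ ^ r ∣ ℓ ^ v x * m' x then ρ x * F (ℓ ^ v x * m' x / ℓ ^ r) else 0) = 0 :=
  law_ramified_eq_zero_of_odd_guarded s F c ρ m' v Fact.out hF hm' ha X hshape
    (guarded_of_nonsquare s F ρ m' v hℓ2 X hshape hnsq) hE hr

end Summit.HodgeConjecture.HodgeConjecture.HodgeLocus.Census.LVRamifiedNonsquare
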